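import Literature.NumberTheory.IwasawaTheory.FukudaGrowthAlgebra
import Mathlib.LinearAlgebra.Quotient.Basic
import Mathlib.LinearAlgebra.Quotient.Card
import Mathlib.LinearAlgebra.Isomorphisms
import HarnessLib

/-!
# «`μ = 0` ⟹ the `p`-ranks are bounded» at finite level — the elementary module algebra
# (`ν_j ≡ (φ − 1)^{p^j − 1} (mod p)` and the nilpotent-filtration count)

Topic `NumberTheory/IwasawaTheory` (namespace = path). THEOREM-ONLY file (no definition, no named fact, no `sorry`), written by the
prover seat `bsd-potss-k8t-c4` g22 (cell `bsd-potss`; μ-road of stmt-BirchSwinnertonDyer-19982; closes nothing). Companion of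
`FukudaGrowthAlgebra.lean` (g20); it supplies the two algebraic bricks of the finite-level proof of
«growth-form `μ = 0` (`ClassicalMuVanishes`) ⟹ `rank_p Cl(K_n)` bounded» (`ClassicalMuVanishesBoundedRankProofs.lean`), the half of
Washington's «`μ = 0` iff `rank A_n` is bounded» (§13.3, proof of Prop. 13.23; Lang Ch. 5 §1 Thm. 1.2) that Iwasawa's structure
theory usually supplies.  Everything is a statement about a FINITE abelian group `V` (a `ℤ`-module), an endomorphism `T` (or `φ`) of
`V`, and `pV := range (p·1)`:

* §1 `exists_geom_sum_eq_X_sub_one_pow_add` — `∑_{i<p^j} X^i = (X − 1)^{p^j−1} + p·R(X)` in `ℤ[X]` (Frobenius in `𝔽_p[X]`: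
  `(∑ X^i)(X − 1) = X^{p^j} − 1 = (X − 1)^{p^j}`); hence `geom_sum_apply_mem`: `(∑_{i<p^j} φ^i) v ∈ (φ − 1)^{p^j−1}V + pV`, and
  `pow_prime_pow_apply_mem_of_pow_eq_one`: `φ^{p^t} = 1 ⟹ (φ − 1)^{p^t} V ⊆ pV`.
* §2 the filtration `W_k = T^kV + pV`: `#(V/W_{k+1}) = #(V/W_k)·c_k` with `c_k ≤ #(V/W_1)` and `c_k = 1 ∨ p ∣ c_k`;
  `W_{k+1} = T(W_k) + pV` (so the filtration is stationary from the first equality on); `W_k = pV` once `T^kV ⊆ pV`.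
* §3 **`card_quotient_smul_le_pow`** — THE COUNT: if `T^NV ⊆ pV` for some `N` and `#(V/W_k) < p^k` for some `k ≥ 1`, then
  `#(V/pV) ≤ #(V/W_1)^{k−1}` (on the `𝔽_p`-space `V/pV` with the nilpotent `T`: `dim V/T^kV < k` forces `T^{k−1} = 0`, and each
  graded piece is a quotient of `V/TV`).
* §4 `exists_mul_add_lt_two_pow` — `∃ j ≥ 1, l·j + a < 2^j` (exponential beats linear; used to pick the window).

References: [Washington1997] L. Washington, *Introduction to Cyclotomic Fields*, 2nd ed., §13.3 (Lemma 13.16, Prop. 13.23 and its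
proof: «`μ = 0` ⟺ `rank A_n` bounded»); [Lang1990] S. Lang, *Cyclotomic Fields I and II*, Ch. 5 §1 Thm. 1.2.
-/

noncomputable section

open Polynomial Finset

namespace Literature.NumberTheory.IwasawaTheory.MuZeroRank

/-! ## §1 `∑_{i<p^j} X^i ≡ (X − 1)^{p^j − 1} (mod p)` and its consequences on modules -/

/-- **`∑_{i<p^j} X^i = (X − 1)^{p^j − 1} + p·R(X)` in `ℤ[X]`** for some `R`: in `𝔽_p[X]`,
`(∑_{i<p^j} X^i)·(X − 1) = X^{p^j} − 1 = (X − 1)^{p^j}` (Frobenius), and `X − 1` is a non-zero-divisor.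
[cite: Washington1997, §13.3 Lemma 13.16 (proof) and Prop. 13.23 (proof: `ν_n ≡ T^{p^n − 1} mod p`)] -/
theorem exists_geom_sum_eq_X_sub_one_pow_add (p j : ℕ) [hp : Fact p.Prime] :
    ∃ R : ℤ[X], (∑ i ∈ range (p ^ j), (X : ℤ[X]) ^ i) = (X - 1) ^ (p ^ j - 1) + C (p : ℤ) * R := by
  set f : ℤ[X] := (∑ i ∈ range (p ^ j), (X : ℤ[X]) ^ i) - (X - 1) ^ (p ^ j - 1) with hf
  have hpj : p ^ j - 1 + 1 = p ^ j := Nat.sub_add_cancel (Nat.one_le_pow _ _ hp.out.pos)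
  have hmap : f.map (Int.castRingHom (ZMod p)) = 0 := by
    have hX1 : (X - 1 : (ZMod p)[X]) ≠ 0 := by
      rw [← C_1]
      exact X_sub_C_ne_zero 1
    have key : (∑ i ∈ range (p ^ j), (X : (ZMod p)[X]) ^ i) * (X - 1) = (X - 1) ^ (p ^ j - 1) * (X - 1) := by
      rw [geom_sum_mul, ← pow_succ, hpj, sub_pow_char_pow, one_pow]
    have key' : (∑ i ∈ range (p ^ j), (X : (ZMod p)[X]) ^ i) = (X - 1) ^ (p ^ j - 1) :=
      mul_right_cancel₀ hX1 key
    have h1 : (∑ i ∈ range (p ^ j), (X : ℤ[X]) ^ i).map (Int.castRingHom (ZMod p)) =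
        ∑ i ∈ range (p ^ j), (X : (ZMod p)[X]) ^ i := by
      rw [Polynomial.map_sum]
      exact Finset.sum_congr rfl fun i _ => by rw [Polynomial.map_pow, Polynomial.map_X]
    have h2 : ((X - 1 : ℤ[X]) ^ (p ^ j - 1)).map (Int.castRingHom (ZMod p)) = (X - 1 : (ZMod p)[X]) ^ (p ^ j - 1) := by
      rw [Polynomial.map_pow, Polynomial.map_sub, Polynomial.map_X, Polynomial.map_one]
    rw [hf, Polynomial.map_sub, h1, h2, key', sub_self]
  have hdvd : C (p : ℤ) ∣ f := by
    rw [C_dvd_iff_dvd_coeff]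
    intro i
    have hi : (Int.castRingHom (ZMod p)) (f.coeff i) = 0 := by
      rw [← Polynomial.coeff_map, hmap, coeff_zero]
    exact (ZMod.intCast_zmod_eq_zero_iff_dvd _ _).mp hi
  obtain ⟨R, hR⟩ := hdvd
  refine ⟨R, ?_⟩
  rw [← hR, hf]
  ring

/-- **`ν_j v ∈ (φ − 1)^{p^j − 1}V + pV`**: for an endomorphism `φ` of an abelian group `V` and `ν_j = ∑_{i<p^j} φ^i`,
every `ν_j v` lies in `range (φ − 1)^{p^j−1} ⊔ range (p·1)`. [cite: Washington1997, §13.3 Prop. 13.23 (proof: `ν_n ≡ T^{p^n − 1} mod p`)] -/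
theorem geom_sum_apply_mem {V : Type*} [AddCommGroup V] (p j : ℕ) [Fact p.Prime] (φ : Module.End ℤ V) (v : V) :
    (∑ i ∈ range (p ^ j), φ ^ i) v ∈
      LinearMap.range ((φ - 1) ^ (p ^ j - 1)) ⊔ LinearMap.range ((p : ℤ) • (1 : Module.End ℤ V)) := by
  obtain ⟨R, hR⟩ := exists_geom_sum_eq_X_sub_one_pow_add p j
  have h := congrArg (aeval φ) hR
  rw [map_sum, map_add, map_pow, map_sub, aeval_X, map_one, map_mul, aeval_C, algebraMap_int_eq, eq_intCast] at h
  simp only [map_pow, aeval_X] at h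
  rw [h, LinearMap.add_apply, Module.End.mul_apply, Module.End.intCast_apply]
  refine Submodule.add_mem_sup ⟨v, rfl⟩ ⟨aeval φ R v, ?_⟩
  rw [LinearMap.smul_apply, Module.End.one_apply]

/-- **`φ^{p^t} = 1 ⟹ (φ − 1)^{p^t} V ⊆ pV`**: `(X + 1)^{p^t} = X^{p^t} + 1 + p·R(X)` at `X = φ − 1` gives
`(φ − 1)^{p^t} = −p·R(φ − 1)`. [cite: Washington1997, §13.3 Lemma 13.16 (proof)] -/
theorem pow_prime_pow_apply_mem_of_pow_eq_one {V : Type*} [AddCommGroup V] (p t : ℕ) [Fact p.Prime] (φ : Module.End ℤ V)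
    (hφ : φ ^ (p ^ t) = 1) (v : V) :
    ((φ - 1) ^ (p ^ t)) v ∈ LinearMap.range ((p : ℤ) • (1 : Module.End ℤ V)) := by
  obtain ⟨R, hR⟩ := FukudaNakayama.exists_X_add_one_pow_prime_pow_eq p t
  have h := congrArg (aeval (φ - 1)) hR
  rw [map_pow, map_add, aeval_X, map_one, sub_add_cancel, hφ, map_add, map_add, map_pow, aeval_X, map_one, map_mul,
    aeval_C, algebraMap_int_eq, eq_intCast] at h
  -- `1 = (φ-1)^{p^t} + 1 + p R(φ-1)`, so `(φ-1)^{p^t} = -(p R(φ-1))`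
  have h0 : (φ - 1) ^ (p ^ t) + ((p : ℤ) : Module.End ℤ V) * aeval (φ - 1) R = 0 := by
    have h1 : (0 : Module.End ℤ V) + 1 = ((φ - 1) ^ (p ^ t) + ((p : ℤ) : Module.End ℤ V) * aeval (φ - 1) R) + 1 := by
      rw [zero_add, add_right_comm]; exact h
    exact (add_right_cancel h1).symm
  have h' : (φ - 1) ^ (p ^ t) = -(((p : ℤ) : Module.End ℤ V) * aeval (φ - 1) R) := eq_neg_of_add_eq_zero_left h0
  refine ⟨-(aeval (φ - 1) R v), ?_⟩
  rw [h', LinearMap.neg_apply, Module.End.mul_apply, Module.End.intCast_apply, LinearMap.smul_apply, Module.End.one_apply,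
    smul_neg]

/-! ## §2 The filtration `W_k = T^k V + pV` -/

section Filtration

variable {V : Type*} [AddCommGroup V] (T : Module.End ℤ V) (p : ℕ)

/-- `W_{k+1} ≤ W_k`. [folklore] -/
private theorem filt_succ_le (k : ℕ) :
    LinearMap.range (T ^ (k + 1)) ⊔ LinearMap.range ((p : ℤ) • (1 : Module.End ℤ V)) ≤
      LinearMap.range (T ^ k) ⊔ LinearMap.range ((p : ℤ) • (1 : Module.End ℤ V)) := by
  refine sup_le_sup_right ?_ _
  rw [pow_succ, Module.End.mul_eq_comp]
  exact LinearMap.range_comp_le_range _ _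

/-- `pV` is `T`-stable: `T(p v) = p (T v)`. [folklore] -/
private theorem map_smul_range_le :
    (LinearMap.range ((p : ℤ) • (1 : Module.End ℤ V))).map T ≤ LinearMap.range ((p : ℤ) • (1 : Module.End ℤ V)) := by
  rintro _ ⟨_, ⟨u, rfl⟩, rfl⟩
  refine ⟨T u, ?_⟩
  simp only [LinearMap.smul_apply, Module.End.one_apply, map_zsmul]

/-- **`W_{k+1} = T(W_k) + pV`.** [folklore] -/
private theorem filt_succ_eq (k : ℕ) :
    LinearMap.range (T ^ (k + 1)) ⊔ LinearMap.range ((p : ℤ) • (1 : Module.End ℤ V)) =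
      (LinearMap.range (T ^ k) ⊔ LinearMap.range ((p : ℤ) • (1 : Module.End ℤ V))).map T ⊔
        LinearMap.range ((p : ℤ) • (1 : Module.End ℤ V)) := by
  rw [Submodule.map_sup, sup_assoc, sup_eq_right.mpr (map_smul_range_le T p), pow_succ', Module.End.mul_eq_comp,
    LinearMap.range_comp]

/-- The filtration is stationary from the first equality on: `W_i = W_{i+1} ⟹ W_m = W_i` for all `m ≥ i`. [folklore] -/
private theorem filt_eq_of_eq {i : ℕ}
    (h : LinearMap.range (T ^ (i + 1)) ⊔ LinearMap.range ((p : ℤ) • (1 : Module.End ℤ V)) =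
      LinearMap.range (T ^ i) ⊔ LinearMap.range ((p : ℤ) • (1 : Module.End ℤ V))) :
    ∀ m, i ≤ m → LinearMap.range (T ^ m) ⊔ LinearMap.range ((p : ℤ) • (1 : Module.End ℤ V)) =
      LinearMap.range (T ^ i) ⊔ LinearMap.range ((p : ℤ) • (1 : Module.End ℤ V)) := by
  intro m hm
  induction m, hm using Nat.le_induction with
  | base => rfl
  | succ m hm ih => rw [filt_succ_eq, ih, ← filt_succ_eq, h]

/-- `W_m = pV` as soon as `T^m V ⊆ pV`. [folklore] -/
private theorem filt_eq_smul_range_of_le {m : ℕ}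
    (h : LinearMap.range (T ^ m) ≤ LinearMap.range ((p : ℤ) • (1 : Module.End ℤ V))) :
    LinearMap.range (T ^ m) ⊔ LinearMap.range ((p : ℤ) • (1 : Module.End ℤ V)) =
      LinearMap.range ((p : ℤ) • (1 : Module.End ℤ V)) :=
  sup_eq_right.mpr h

/-- `T^N V ⊆ pV ⟹ T^m V ⊆ pV` for `m ≥ N`. [folklore] -/
private theorem range_pow_le_of_le {N : ℕ}
    (h : LinearMap.range (T ^ N) ≤ LinearMap.range ((p : ℤ) • (1 : Module.End ℤ V))) {m : ℕ} (hm : N ≤ m) :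
    LinearMap.range (T ^ m) ≤ LinearMap.range ((p : ℤ) • (1 : Module.End ℤ V)) := by
  obtain ⟨d, rfl⟩ := Nat.exists_eq_add_of_le hm
  rw [pow_add, Module.End.mul_eq_comp]
  exact (LinearMap.range_comp_le_range _ _).trans h

variable [Finite V]

omit [Finite V] in
/-- **`#(V/Y) = #(V/X) · #(X/Y)`** for submodules `Y ≤ X` (third isomorphism theorem, cardinality form; `X/Y` read as the
image of `X` in `V/Y`). [folklore] -/
private theorem card_quotient_eq_mul {X Y : Submodule ℤ V} (h : Y ≤ X) :
    Nat.card (V ⧸ Y) = Nat.card (V ⧸ X) * Nat.card (X.map Y.mkQ) := by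
  rw [Submodule.card_eq_card_quotient_mul_card (X.map Y.mkQ), mul_comm,
    Nat.card_congr (Submodule.quotientQuotientEquivQuotient Y X h).toEquiv]

/-- **`c_k ≤ #(V/W_1)`**: the graded piece `W_k/W_{k+1}` is the image of `v ↦ [T^k v]`, a map killing `W_1 = TV + pV`, hence a
quotient of `V/W_1`. [cite: Washington1997, §13.3 Prop. 13.23 (proof)] -/
private theorem card_map_mkQ_le (k : ℕ) :
    Nat.card ((LinearMap.range (T ^ k) ⊔ LinearMap.range ((p : ℤ) • (1 : Module.End ℤ V))).map
        (LinearMap.range (T ^ (k + 1)) ⊔ LinearMap.range ((p : ℤ) • (1 : Module.End ℤ V))).mkQ) ≤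
      Nat.card (V ⧸ (LinearMap.range T ⊔ LinearMap.range ((p : ℤ) • (1 : Module.End ℤ V)))) := by
  set P : Submodule ℤ V := LinearMap.range ((p : ℤ) • (1 : Module.End ℤ V)) with hP
  set W1 : Submodule ℤ V := LinearMap.range (T ^ (k + 1)) ⊔ P with hW1
  set f := W1.mkQ ∘ₗ (T ^ k) with hf
  have hPW1 : P ≤ LinearMap.ker W1.mkQ := by rw [Submodule.ker_mkQ]; exact le_sup_right
  have hrange : (LinearMap.range (T ^ k) ⊔ P).map W1.mkQ = LinearMap.range f := by
    rw [Submodule.map_sup, LinearMap.le_ker_iff_map.mp hPW1, sup_bot_eq, hf, LinearMap.range_comp]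
  have hker : LinearMap.range T ⊔ P ≤ LinearMap.ker f := by
    refine sup_le ?_ ?_
    · rintro _ ⟨a, rfl⟩
      rw [LinearMap.mem_ker, hf, LinearMap.comp_apply]
      refine (Submodule.Quotient.mk_eq_zero W1).mpr (Submodule.mem_sup_left ⟨a, ?_⟩)
      rw [pow_succ, Module.End.mul_apply]
    · rintro _ ⟨b, rfl⟩
      rw [LinearMap.mem_ker, hf, LinearMap.comp_apply]
      refine (Submodule.Quotient.mk_eq_zero W1).mpr (Submodule.mem_sup_right ⟨(T ^ k) b, ?_⟩)
      simp only [LinearMap.smul_apply, Module.End.one_apply, map_zsmul]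
  haveI : Finite (V ⧸ LinearMap.ker f) := Finite.of_surjective _ (Submodule.Quotient.mk_surjective _)
  haveI : Finite (V ⧸ (LinearMap.range T ⊔ P)) := Finite.of_surjective _ (Submodule.Quotient.mk_surjective _)
  rw [hrange, ← Nat.card_congr (LinearMap.quotKerEquivRange f).toEquiv]
  exact Nat.card_le_card_of_surjective _ (Submodule.factor_surjective hker)

/-- **`#(V/W_{k+1}) ≤ #(V/W_k) · #(V/W_1)`.** [cite: Washington1997, §13.3 Prop. 13.23 (proof)] -/
private theorem card_quotient_succ_le (k : ℕ) :
    Nat.card (V ⧸ (LinearMap.range (T ^ (k + 1)) ⊔ LinearMap.range ((p : ℤ) • (1 : Module.End ℤ V)))) ≤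
      Nat.card (V ⧸ (LinearMap.range (T ^ k) ⊔ LinearMap.range ((p : ℤ) • (1 : Module.End ℤ V)))) *
        Nat.card (V ⧸ (LinearMap.range T ⊔ LinearMap.range ((p : ℤ) • (1 : Module.End ℤ V)))) := by
  rw [card_quotient_eq_mul (filt_succ_le T p k)]
  exact Nat.mul_le_mul_left _ (card_map_mkQ_le T p k)

/-- `#(V/W_m) ≤ #(V/W_1)^m`. [cite: Washington1997, §13.3 Prop. 13.23 (proof)] -/
private theorem card_quotient_le_pow (m : ℕ) :
    Nat.card (V ⧸ (LinearMap.range (T ^ m) ⊔ LinearMap.range ((p : ℤ) • (1 : Module.End ℤ V)))) ≤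
      Nat.card (V ⧸ (LinearMap.range T ⊔ LinearMap.range ((p : ℤ) • (1 : Module.End ℤ V)))) ^ m := by
  induction m with
  | zero =>
    rw [pow_zero, pow_zero, Module.End.one_eq_id, LinearMap.range_id, top_sup_eq, Nat.card_unique]
  | succ m ih =>
    calc _ ≤ _ := card_quotient_succ_le T p m
      _ ≤ _ := by rw [pow_succ]; exact Nat.mul_le_mul_right _ ih

omit [Finite V] in
/-- **`c_k = 1` or `p ∣ c_k`** (`p` prime): the graded piece `W_k/W_{k+1}` is killed by `p` (as `pV ⊆ W_{k+1}`), so if it is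
non-trivial it contains an element of additive order `p`. [folklore] -/
private theorem eq_or_dvd_card_map_mkQ [hp : Fact p.Prime] (k : ℕ) :
    LinearMap.range (T ^ (k + 1)) ⊔ LinearMap.range ((p : ℤ) • (1 : Module.End ℤ V)) =
        LinearMap.range (T ^ k) ⊔ LinearMap.range ((p : ℤ) • (1 : Module.End ℤ V)) ∨
      p ∣ Nat.card ((LinearMap.range (T ^ k) ⊔ LinearMap.range ((p : ℤ) • (1 : Module.End ℤ V))).map
        (LinearMap.range (T ^ (k + 1)) ⊔ LinearMap.range ((p : ℤ) • (1 : Module.End ℤ V))).mkQ) := by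
  set P : Submodule ℤ V := LinearMap.range ((p : ℤ) • (1 : Module.End ℤ V)) with hP
  set W1 : Submodule ℤ V := LinearMap.range (T ^ (k + 1)) ⊔ P with hW1
  set W0 : Submodule ℤ V := LinearMap.range (T ^ k) ⊔ P with hW0
  by_cases hbot : W0.map W1.mkQ = ⊥
  · left
    rw [← LinearMap.le_ker_iff_map, Submodule.ker_mkQ] at hbot
    exact le_antisymm (filt_succ_le T p k) hbot
  · right
    obtain ⟨x, hx, hx0⟩ := (Submodule.ne_bot_iff _).mp hbot
    -- `p • x = 0` in `V ⧸ W1`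
    have hpx : p • x = 0 := by
      obtain ⟨v, -, rfl⟩ := Submodule.mem_map.mp hx
      rw [← map_nsmul, Submodule.mkQ_apply]
      refine (Submodule.Quotient.mk_eq_zero W1).mpr (Submodule.mem_sup_right ⟨v, ?_⟩)
      rw [LinearMap.smul_apply, Module.End.one_apply, natCast_zsmul]
    let y : ↥(W0.map W1.mkQ) := ⟨x, hx⟩
    have hy0 : y ≠ 0 := fun h => hx0 (congrArg Subtype.val h)
    have hpy : p • y = 0 := Subtype.ext hpx
    have hord : addOrderOf y = p := by
      have hdvd : addOrderOf y ∣ p := addOrderOf_dvd_of_nsmul_eq_zero hpy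
      rcases (Nat.dvd_prime hp.out).mp hdvd with h1 | h1
      · exact absurd (AddMonoid.addOrderOf_eq_one_iff.mp h1) hy0
      · exact h1
    rw [← hord]
    exact addOrderOf_dvd_natCard y

omit [Finite V] in
/-- If `W_{i+1} ≠ W_i` for all `i < k` then `p^k ∣ #(V/W_k)`. [folklore] -/
private theorem pow_dvd_card_quotient_of_forall_ne [Fact p.Prime] {k : ℕ}
    (h : ∀ i, i < k → LinearMap.range (T ^ (i + 1)) ⊔ LinearMap.range ((p : ℤ) • (1 : Module.End ℤ V)) ≠
      LinearMap.range (T ^ i) ⊔ LinearMap.range ((p : ℤ) • (1 : Module.End ℤ V))) :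
    p ^ k ∣ Nat.card (V ⧸ (LinearMap.range (T ^ k) ⊔ LinearMap.range ((p : ℤ) • (1 : Module.End ℤ V)))) := by
  induction k with
  | zero => exact ⟨_, (one_mul _).symm⟩
  | succ k ih =>
    rw [card_quotient_eq_mul (filt_succ_le T p k), pow_succ]
    refine mul_dvd_mul (ih fun i hi => h i (Nat.lt_succ_of_lt hi)) ?_
    rcases eq_or_dvd_card_map_mkQ T p k with h1 | h1
    · exact absurd h1 (h k (Nat.lt_succ_self k))
    · exact h1

end Filtration

/-! ## §3 The count -/

/-- **THE NILPOTENT-FILTRATION COUNT.** Let `V` be a finite abelian group, `p` a prime, `T` an endomorphism with `T^N V ⊆ pV` for some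
`N` (i.e. `T` nilpotent on `V/pV`), and `k ≥ 1` with `#(V/(T^kV + pV)) < p^k`. Then `#(V/pV) ≤ #(V/(TV + pV))^{k−1}`.  (On the
`𝔽_p`-space `V̄ = V/pV`: `dim V̄/T^kV̄ < k` forces two consecutive terms of `V̄ ⊇ TV̄ ⊇ T²V̄ ⊇ ⋯ ⊇ T^kV̄` to agree, whence
`T^{k−1}V̄ = 0` by nilpotency, and each `T^iV̄/T^{i+1}V̄` is a quotient of `V̄/TV̄`.)  This is the finite shadow of «if `X/pX` is
infinite then `rank A_n ≥ p^n − 1`» in Washington's proof of «`μ = 0` ⟺ `rank A_n` bounded».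
[cite: Washington1997, §13.3 Prop. 13.23 (proof)] [cite: Lang1990, Ch. 5 §1 Thm. 1.2] -/
theorem card_quotient_smul_le_pow {V : Type*} [AddCommGroup V] [Finite V] {p : ℕ} [Fact p.Prime] (T : Module.End ℤ V)
    (hT : ∃ N : ℕ, LinearMap.range (T ^ N) ≤ LinearMap.range ((p : ℤ) • (1 : Module.End ℤ V))) {k : ℕ} (hk : 1 ≤ k)
    (hlt : Nat.card (V ⧸ (LinearMap.range (T ^ k) ⊔ LinearMap.range ((p : ℤ) • (1 : Module.End ℤ V)))) < p ^ k) :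
    Nat.card (V ⧸ LinearMap.range ((p : ℤ) • (1 : Module.End ℤ V))) ≤
      Nat.card (V ⧸ (LinearMap.range T ⊔ LinearMap.range ((p : ℤ) • (1 : Module.End ℤ V)))) ^ (k - 1) := by
  obtain ⟨N, hN⟩ := hT
  -- some step of the filtration before `k` is an equality
  have hex : ∃ i, i < k ∧ LinearMap.range (T ^ (i + 1)) ⊔ LinearMap.range ((p : ℤ) • (1 : Module.End ℤ V)) =
      LinearMap.range (T ^ i) ⊔ LinearMap.range ((p : ℤ) • (1 : Module.End ℤ V)) := by
    by_contra hne
    push Not at hne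
    have hdvd := pow_dvd_card_quotient_of_forall_ne T p (k := k) hne
    haveI : Finite (V ⧸ (LinearMap.range (T ^ k) ⊔ LinearMap.range ((p : ℤ) • (1 : Module.End ℤ V)))) :=
      Finite.of_surjective _ (Submodule.Quotient.mk_surjective _)
    exact absurd (Nat.le_of_dvd Nat.card_pos hdvd) (not_le.mpr hlt)
  obtain ⟨i, hik, hi⟩ := hex
  -- hence `W_{k-1} = W_i = W_{max i N} = pV`
  have hstat := filt_eq_of_eq T p hi
  have h1 : LinearMap.range (T ^ (k - 1)) ⊔ LinearMap.range ((p : ℤ) • (1 : Module.End ℤ V)) =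
      LinearMap.range ((p : ℤ) • (1 : Module.End ℤ V)) := by
    rw [hstat (k - 1) (by omega), ← hstat (max i N) (le_max_left _ _)]
    exact filt_eq_smul_range_of_le T p (range_pow_le_of_le T p hN (le_max_right _ _))
  have h2 := card_quotient_le_pow T p (k - 1)
  rw [h1] at h2
  exact h2

/-- Antitonicity of `#(V/·)`: `S ≤ S' ⟹ #(V/S') ≤ #(V/S)` (elementary; the comparison `rank A_n = dim X/(ν_nY₀ + pX) ≥ dim X/(T^{p^n−1}X + pX)`
in Washington's proof uses exactly this). [cite: Washington1997, §13.3 Prop. 13.23 (proof)] -/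
theorem card_quotient_le_of_le {V : Type*} [AddCommGroup V] [Finite V] {S S' : Submodule ℤ V} (h : S ≤ S') :
    Nat.card (V ⧸ S') ≤ Nat.card (V ⧸ S) := by
  haveI : Finite (V ⧸ S) := Finite.of_surjective _ (Submodule.Quotient.mk_surjective _)
  exact Nat.card_le_card_of_surjective _ (Submodule.factor_surjective h)

/-! ## §4 Exponential beats linear -/

/-- `2m² + m < 4^m` for `m ≥ 1`. [folklore] -/
private theorem two_mul_sq_add_lt_four_pow {m : ℕ} (hm : 1 ≤ m) : 2 * m * m + m < 4 ^ m := by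
  induction m, hm using Nat.le_induction with
  | base => norm_num
  | succ m hm ih =>
    have h4 : 4 ^ (m + 1) = 4 * 4 ^ m := by rw [pow_succ, mul_comm]
    rw [h4]
    nlinarith

/-- **`∃ j ≥ 1, l·j + a < 2^j`** (exponential beats linear: `j = 2(a + l + 1)`; the elementary comparison of the `μ p^n` and `λ n`
terms behind «`μ = 0` iff `rank A_n` is bounded»). [cite: Washington1997, §13.3 Prop. 13.23 (proof)] -/
theorem exists_mul_add_lt_two_pow (l a : ℕ) : ∃ j : ℕ, 1 ≤ j ∧ l * j + a < 2 ^ j := by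
  set m := a + l + 1 with hm
  refine ⟨2 * m, by omega, ?_⟩
  have h := two_mul_sq_add_lt_four_pow (m := m) (by omega)
  have h4 : (4 : ℕ) ^ m = 2 ^ (2 * m) := by
    rw [pow_mul]; norm_num
  rw [← h4]
  calc l * (2 * m) + a ≤ 2 * m * m + m := by nlinarith
    _ < 4 ^ m := h

end Literature.NumberTheory.IwasawaTheory.MuZeroRank

end
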